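import Mathlib
import HarnessLib

/-!
# Route `UnthreadedDoor` / `ThreadingFlux`, crux `PoloidalLiouville` (stmt-NavierStokesRegularity-1222), antidynamo v2 skeleton,
# rung `stub_singleDegreeRung`, EVEN degree — TRANSLATION RIGIDITY of a single-degree field `w x = G(‖x − x₀‖) • Λ(x − x₀)` (pure)

Support file (census instrument decomp-ns-census-1 g33, cell decomp-ns; `--supports stmt-NavierStokesRegularity-1222 --as helper`; 0 kit).
Pure real analysis, no Navier–Stokes: the input of the STAGNATION ALTERNATIVE of the even rung
(`…AntidynamoEvenRungStagnation`, same seat), where `w = curl (v t)`, `Λ = ∇P × id` and `b = v t x₀` (parity identity of p798954).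

* `eq_mul_rpow_of_mul_deriv_eq` / `eq_of_mul_deriv_eq_of_bounded` — Euler's equation `r M′ = δ M` on `(0,∞)`: `M(r) = M(r₁)(r/r₁)^δ`;
  a bounded solution with `M(r₁) ≠ 0` is constant (`r → ∞` kills `δ > 0`, `r → 0⁺` kills `δ < 0`).
* `fderiv_apply_smul_of_homogeneous` — `DΛ(r y) b = r^{l−1} DΛ(y) b` for `Λ` differentiable, positively homogeneous of degree `l ≥ 1`.
* `key_of_fderiv_apply_eq_zero` / `key_ray` — if `∂_b w ≡ 0` off `x₀` then `G(‖y‖) • DΛ(y) b + (G′(‖y‖)⟪y,b⟫/‖y‖) • Λ y = 0` for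
  `y ≠ 0` (differentiate `s ↦ w(x₀ + y + s b)` at `0` in two ways), i.e. along rays `(r G′(r)⟪u,b⟫) • Λ u + G(r) • DΛ(u) b = 0`.
* ★★ `vortAmp_eq_zero_of_fderiv_apply_eq_zero` — `w` differentiable and bounded, `Λ` differentiable, positively homogeneous of degree
  `l ≥ 1`, TANGENT (`⟪y, Λ y⟫ = 0`) with `Λ ξ ≠ 0` for a unit `ξ`, `G` differentiable on `(0,∞)`, `∂_b w ≡ 0` off `x₀` for some
  `b ≠ 0` ⟹ `G ≡ 0` on `(0,∞)`.  PROOF (no harmonicity, no algebra of the profile): (I) if two radii give linearly independent pairs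
  `(r G′, G)`, the ray identity gives `⟪u,b⟫ • Λ u = 0` for every unit `u`, so `Λ` vanishes at `ξ + ε b` for `ε ≠ 0` (or at `ξ`), whence
  `Λ ξ = 0`; (II) otherwise `r G′ = d G`, `M(r) := G(r) r^l` solves `r M′ = (d+l) M` and is bounded along the ray `x₀ + rξ` (by `‖w‖ ≤ K`),
  so it is the non-zero constant `M(r₁)`: `w(x₀ + r u) = M(r₁) • Λ u` on every ray, continuity at `x₀` gives `Λ u = c` for every unit
  `u`, and tangency `⟪u, c⟫ = 0` for all `u` gives `c = 0`, so `Λ ξ = 0` — absurd either way.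

HONEST LABEL: elementary one-variable calculus; serves the open EVEN-degree rung of an S-free Liouville engine (crux 1222 is INCOMPARABLE
with the summit; descent inside the door's cone, decorative for the summit).  Nothing here proves NavierStokesRegularity. [folklore]
-/

noncomputable section

-- the summit and its single sub-problem share the name (CONVENTIONS §1), as in every Theorems file
set_option linter.dupNamespace false

open scoped Topology InnerProductSpace RealInnerProductSpace
open Filter Set Metric

namespace Summit.NavierStokesRegularity.NavierStokesRegularity.Theorems.PoloidalLiouville.Antidynamo

/-! ### Euler's equation `r M′ = δ M` on `(0,∞)` -/

/-- **EULER'S ODE.**  If `M` is differentiable on `(0,∞)` with `r · M′(r) = δ · M(r)` there, then `M(r) = M(r₁) · (r/r₁)^δ`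
(the function `M(r) r^{−δ}` has zero derivative on the connected open set `(0,∞)`). [folklore] -/
theorem eq_mul_rpow_of_mul_deriv_eq {M : ℝ → ℝ} (hM : ∀ r, 0 < r → DifferentiableAt ℝ M r) {δ : ℝ}
    (h : ∀ r, 0 < r → r * deriv M r = δ * M r) {r₁ : ℝ} (hr₁ : 0 < r₁) :
    ∀ r, 0 < r → M r = M r₁ * (r / r₁) ^ δ := by
  set F : ℝ → ℝ := fun r => M r * r ^ (-δ) with hF
  have hFd : ∀ r, 0 < r → HasDerivAt F (deriv M r * r ^ (-δ) + M r * (-δ * r ^ (-δ - 1))) r := fun r hr =>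
    (hM r hr).hasDerivAt.mul (Real.hasDerivAt_rpow_const (Or.inl hr.ne'))
  have hF0 : ∀ r, 0 < r → deriv F r = 0 := by
    intro r hr
    rw [(hFd r hr).deriv]
    have hsplit : r ^ (-δ) = r ^ (-δ - 1) * r := by
      rw [← Real.rpow_add_one hr.ne' (-δ - 1)]; ring_nf
    rw [hsplit]
    have := h r hr
    linear_combination r ^ (-δ - 1) * this
  have hconst : ∀ r, 0 < r → F r = F r₁ := fun r hr =>
    isOpen_Ioi.is_const_of_deriv_eq_zero isPreconnected_Ioi
      (fun s hs => ((hFd s hs).differentiableAt).differentiableWithinAt) (fun s hs => hF0 s hs) hr hr₁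
  intro r hr
  have h1 := hconst r hr
  simp only [hF] at h1
  -- `h1 : M r * r ^ (-δ) = M r₁ * r₁ ^ (-δ)`
  have hrδ : r ^ (-δ) = (r ^ δ)⁻¹ := Real.rpow_neg hr.le δ
  have hr₁δ : r₁ ^ (-δ) = (r₁ ^ δ)⁻¹ := Real.rpow_neg hr₁.le δ
  have hpos : 0 < r ^ δ := Real.rpow_pos_of_pos hr δ
  have hpos₁ : 0 < r₁ ^ δ := Real.rpow_pos_of_pos hr₁ δ
  rw [Real.div_rpow hr.le hr₁.le]
  rw [hrδ, hr₁δ] at h1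
  field_simp at h1
  field_simp
  linear_combination h1

/-- **A BOUNDED SOLUTION OF EULER'S ODE ON `(0,∞)` THAT DOES NOT VANISH IS CONSTANT**: with `r M′ = δ M`, `M(r₁) ≠ 0` and
`|M| ≤ K` on `(0,∞)`, letting `r → ∞` excludes `δ > 0` and `r → 0⁺` excludes `δ < 0`; so `δ = 0` and `M ≡ M(r₁)`. [folklore] -/
theorem eq_of_mul_deriv_eq_of_bounded {M : ℝ → ℝ} (hM : ∀ r, 0 < r → DifferentiableAt ℝ M r) {δ : ℝ}
    (h : ∀ r, 0 < r → r * deriv M r = δ * M r) {r₁ : ℝ} (hr₁ : 0 < r₁) (hM₁ : M r₁ ≠ 0)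
    {K : ℝ} (hK : ∀ r, 0 < r → |M r| ≤ K) :
    ∀ r, 0 < r → M r = M r₁ := by
  have hsol := eq_mul_rpow_of_mul_deriv_eq hM h hr₁
  have hA : 0 < |M r₁| := abs_pos.mpr hM₁
  -- the ratio `K / |M r₁|` bounds every `(r/r₁)^δ`
  have hbd : ∀ r, 0 < r → (r / r₁) ^ δ ≤ K / |M r₁| := by
    intro r hr
    rw [le_div_iff₀ hA]
    have h1 := hK r hr
    rw [hsol r hr, abs_mul, abs_of_pos (Real.rpow_pos_of_pos (div_pos hr hr₁) δ)] at h1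
    linarith [mul_comm ((r / r₁) ^ δ) (|M r₁|)]
  have hδ : δ = 0 := by
    by_contra hne
    rcases lt_or_gt_of_ne hne with hlt | hgt
    · -- `δ < 0`: along `r = r₁ / T`, `(r/r₁)^δ = T^(-δ) → ∞`
      have ht : Tendsto (fun T : ℝ => T ^ (-δ)) atTop atTop := tendsto_rpow_atTop (by linarith)
      obtain ⟨T, hT1, hT2⟩ := ((ht.eventually_gt_atTop (K / |M r₁|)).and (eventually_gt_atTop 0)).exists
      have hr : 0 < r₁ / T := div_pos hr₁ hT2
      have h1 := hbd _ hr
      have h2 : (r₁ / T / r₁) ^ δ = T ^ (-δ) := by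
        have e : r₁ / T / r₁ = T⁻¹ := by field_simp
        rw [e, Real.inv_rpow hT2.le, Real.rpow_neg hT2.le]
      rw [h2] at h1
      linarith
    · -- `δ > 0`: along `r = r₁ T`, `(r/r₁)^δ = T^δ → ∞`
      have ht : Tendsto (fun T : ℝ => T ^ δ) atTop atTop := tendsto_rpow_atTop hgt
      obtain ⟨T, hT1, hT2⟩ := ((ht.eventually_gt_atTop (K / |M r₁|)).and (eventually_gt_atTop 0)).exists
      have hr : 0 < r₁ * T := mul_pos hr₁ hT2
      have h1 := hbd _ hr
      have h2 : (r₁ * T / r₁) ^ δ = T ^ δ := by rw [mul_div_cancel_left₀ _ hr₁.ne']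
      rw [h2] at h1
      linarith
  intro r hr
  rw [hsol r hr, hδ, Real.rpow_zero, mul_one]

/-! ### Calculus of a single-degree field `w x = G(‖x − x₀‖) • Λ(x − x₀)` along lines -/

/-- Derivative homogeneity: for `Λ` differentiable and positively homogeneous of degree `l ≥ 1`,
`DΛ(r y) b = r^{l−1} DΛ(y) b` (chain rule on `y ↦ Λ(r y) = r^l Λ(y)`). [folklore] -/
theorem fderiv_apply_smul_of_homogeneous {Λ : EuclideanSpace ℝ (Fin 3) → EuclideanSpace ℝ (Fin 3)} (hΛ : Differentiable ℝ Λ)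
    {l : ℕ} (hl : 1 ≤ l) (hhom : ∀ r : ℝ, 0 < r → ∀ y : EuclideanSpace ℝ (Fin 3), Λ (r • y) = r ^ l • Λ y)
    {r : ℝ} (hr : 0 < r) (y b : EuclideanSpace ℝ (Fin 3)) :
    fderiv ℝ Λ (r • y) b = r ^ (l - 1) • fderiv ℝ Λ y b := by
  have hs : HasFDerivAt (fun z : EuclideanSpace ℝ (Fin 3) => r • z)
      (r • ContinuousLinearMap.id ℝ (EuclideanSpace ℝ (Fin 3))) y := (hasFDerivAt_id y).const_smul r
  have h1 : HasFDerivAt (fun z : EuclideanSpace ℝ (Fin 3) => Λ (r • z))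
      ((fderiv ℝ Λ (r • y)).comp (r • ContinuousLinearMap.id ℝ (EuclideanSpace ℝ (Fin 3)))) y :=
    (hΛ (r • y)).hasFDerivAt.comp y hs
  have h2 : HasFDerivAt (fun z : EuclideanSpace ℝ (Fin 3) => Λ (r • z)) (r ^ l • fderiv ℝ Λ y) y := by
    have : (fun z : EuclideanSpace ℝ (Fin 3) => Λ (r • z)) = fun z => r ^ l • Λ z := funext (hhom r hr)
    rw [this]
    exact (hΛ y).hasFDerivAt.const_smul (r ^ l)
  have h12 := congrArg (fun L : EuclideanSpace ℝ (Fin 3) →L[ℝ] EuclideanSpace ℝ (Fin 3) => L b) (h1.unique h2)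
  simp only [ContinuousLinearMap.coe_comp, Function.comp_apply, _root_.smul_apply,
    ContinuousLinearMap.coe_id', id_eq, map_smul] at h12
  -- `h12 : r • DΛ(r y) b = r ^ l • DΛ(y) b`
  have hrl : r ^ l = r * r ^ (l - 1) := by
    rw [← pow_succ']; congr 1; omega
  rw [hrl, mul_smul] at h12
  exact smul_right_injective _ hr.ne' h12

/-- **THE KEY IDENTITY.**  If `w` is differentiable with `w x = G(‖x − x₀‖) • Λ(x − x₀)` off `x₀` (`Λ` differentiable, `G` differentiable
on `(0,∞)`) and `∂_b w(x) = 0` off `x₀`, then for every `y ≠ 0`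
`G(‖y‖) • DΛ(y) b + (G′(‖y‖) ⟪y, b⟫ / ‖y‖) • Λ(y) = 0` (differentiate `s ↦ w(x₀ + y + s b)` at `s = 0` in two ways). [folklore] -/
theorem key_of_fderiv_apply_eq_zero {Λ w : EuclideanSpace ℝ (Fin 3) → EuclideanSpace ℝ (Fin 3)} (hΛ : Differentiable ℝ Λ)
    {x₀ : EuclideanSpace ℝ (Fin 3)} (hw : Differentiable ℝ w) {G : ℝ → ℝ} (hG : ∀ r, 0 < r → DifferentiableAt ℝ G r)
    (hrep : ∀ x, x ≠ x₀ → w x = G ‖x - x₀‖ • Λ (x - x₀)) {b : EuclideanSpace ℝ (Fin 3)}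
    (hb : ∀ x, x ≠ x₀ → fderiv ℝ w x b = 0) {y : EuclideanSpace ℝ (Fin 3)} (hy : y ≠ 0) :
    G ‖y‖ • fderiv ℝ Λ y b + (deriv G ‖y‖ * (⟪y, b⟫ / ‖y‖)) • Λ y = 0 := by
  have hy' : 0 < ‖y‖ := norm_pos_iff.mpr hy
  -- the line `s ↦ y + s b`
  have hL : HasDerivAt (fun s : ℝ => y + s • b) b 0 := by
    simpa using ((hasDerivAt_id (0 : ℝ)).smul_const b).const_add y
  have hL0 : y + (0 : ℝ) • b = y := by rw [zero_smul, add_zero]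
  -- (1) `s ↦ w (x₀ + (y + s b))` has derivative `Dw(x₀ + y) b = 0` at `0`
  have hγ : HasDerivAt (fun s : ℝ => w (x₀ + (y + s • b))) (fderiv ℝ w (x₀ + y) b) 0 := by
    have hL' : HasDerivAt (fun s : ℝ => x₀ + (y + s • b)) b 0 := hL.const_add x₀
    have h := (hw (x₀ + (y + (0 : ℝ) • b))).hasFDerivAt.comp_hasDerivAt (0 : ℝ) hL'
    rw [hL0] at h
    exact h
  have hx : x₀ + y ≠ x₀ := by
    intro h; apply hy; simpa using h
  rw [hb _ hx] at hγ
  -- (2) the same function is `s ↦ G ‖y + s b‖ • Λ (y + s b)` near `s = 0`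
  have hnorm : HasDerivAt (fun s : ℝ => ‖y + s • b‖) (⟪y, b⟫ / ‖y‖) 0 := by
    have hsq : HasDerivAt (fun s : ℝ => ‖y + s • b‖ ^ 2) (2 * ⟪y + (0 : ℝ) • b, b⟫) 0 := hL.norm_sq
    rw [hL0] at hsq
    have hne : ‖y + (0 : ℝ) • b‖ ^ 2 ≠ 0 := by rw [hL0]; positivity
    have hsqrt := hsq.sqrt hne
    have hfun : (fun s : ℝ => Real.sqrt (‖y + s • b‖ ^ 2)) = fun s => ‖y + s • b‖ :=
      funext fun s => Real.sqrt_sq (norm_nonneg _)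
    rw [hfun, hL0, Real.sqrt_sq (norm_nonneg _)] at hsqrt
    convert hsqrt using 1
    field_simp
  have hGn : HasDerivAt (fun s : ℝ => G ‖y + s • b‖) (deriv G ‖y‖ * (⟪y, b⟫ / ‖y‖)) 0 := by
    have hG' : HasDerivAt G (deriv G ‖y + (0 : ℝ) • b‖) ‖y + (0 : ℝ) • b‖ := by
      rw [hL0]; exact (hG ‖y‖ hy').hasDerivAt
    have h := hG'.comp (0 : ℝ) hnorm
    rw [hL0] at h
    exact h
  have hΛn : HasDerivAt (fun s : ℝ => Λ (y + s • b)) (fderiv ℝ Λ y b) 0 := by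
    have h := (hΛ (y + (0 : ℝ) • b)).hasFDerivAt.comp_hasDerivAt (0 : ℝ) hL
    rw [hL0] at h
    exact h
  have hprod : HasDerivAt (fun s : ℝ => G ‖y + s • b‖ • Λ (y + s • b))
      (G ‖y‖ • fderiv ℝ Λ y b + (deriv G ‖y‖ * (⟪y, b⟫ / ‖y‖)) • Λ y) 0 := by
    have h := hGn.smul hΛn
    simp only [zero_smul, add_zero] at h
    exact h
  -- the two functions agree near `s = 0`
  have hev : (fun s : ℝ => w (x₀ + (y + s • b))) =ᶠ[𝓝 0] fun s => G ‖y + s • b‖ • Λ (y + s • b) := by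
    have hc : ContinuousAt (fun s : ℝ => y + s • b) 0 := hL.continuousAt
    have hne : ∀ᶠ s in 𝓝 (0 : ℝ), y + s • b ≠ 0 := by
      refine hc.eventually_ne ?_
      rw [hL0]; exact hy
    filter_upwards [hne] with s hs
    have hxs : x₀ + (y + s • b) ≠ x₀ := by
      intro h; apply hs; simpa using h
    rw [hrep _ hxs, add_sub_cancel_left]
  have hγ' := hprod.congr_of_eventuallyEq hev
  exact hγ'.unique hγ

/-- **THE KEY IDENTITY ALONG RAYS.**  In the situation of `key_of_fderiv_apply_eq_zero`, with `Λ` positively homogeneous of degree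
`l ≥ 1`: `(r G′(r) ⟪u, b⟫) • Λ u + G(r) • DΛ(u) b = 0` for every `r > 0` and every unit vector `u`. [folklore] -/
theorem key_ray {Λ w : EuclideanSpace ℝ (Fin 3) → EuclideanSpace ℝ (Fin 3)} (hΛ : Differentiable ℝ Λ) {l : ℕ} (hl : 1 ≤ l)
    (hhom : ∀ r : ℝ, 0 < r → ∀ y : EuclideanSpace ℝ (Fin 3), Λ (r • y) = r ^ l • Λ y)
    {x₀ : EuclideanSpace ℝ (Fin 3)} (hw : Differentiable ℝ w) {G : ℝ → ℝ} (hG : ∀ r, 0 < r → DifferentiableAt ℝ G r)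
    (hrep : ∀ x, x ≠ x₀ → w x = G ‖x - x₀‖ • Λ (x - x₀)) {b : EuclideanSpace ℝ (Fin 3)}
    (hb : ∀ x, x ≠ x₀ → fderiv ℝ w x b = 0) {r : ℝ} (hr : 0 < r) {u : EuclideanSpace ℝ (Fin 3)} (hu : ‖u‖ = 1) :
    (r * deriv G r * ⟪u, b⟫) • Λ u + G r • fderiv ℝ Λ u b = 0 := by
  have hu0 : u ≠ 0 := by
    intro h; rw [h, norm_zero] at hu; exact zero_ne_one hu
  have hy : r • u ≠ 0 := smul_ne_zero hr.ne' hu0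
  have hn : ‖r • u‖ = r := by rw [norm_smul, Real.norm_eq_abs, abs_of_pos hr, hu, mul_one]
  have h := key_of_fderiv_apply_eq_zero hΛ hw hG hrep hb hy
  rw [hn, fderiv_apply_smul_of_homogeneous hΛ hl hhom hr u b, hhom r hr u, real_inner_smul_left, smul_smul, smul_smul,
    mul_div_cancel_left₀ _ hr.ne'] at h
  -- `h : (G r * r ^ (l-1)) • DΛ u b + (G′ r * ⟪u,b⟫ * r ^ l) • Λ u = 0`
  have hrl : r ^ l = r * r ^ (l - 1) := by
    rw [← pow_succ']; congr 1; omega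
  have h2 : r ^ (l - 1) • ((r * deriv G r * ⟪u, b⟫) • Λ u + G r • fderiv ℝ Λ u b) = 0 := by
    have e1 : r ^ (l - 1) * (r * deriv G r * ⟪u, b⟫) = deriv G r * ⟪u, b⟫ * r ^ l := by rw [hrl]; ring
    have e2 : r ^ (l - 1) * G r = G r * r ^ (l - 1) := mul_comm _ _
    rw [smul_add, smul_smul, smul_smul, e1, e2, add_comm, h]
  exact (smul_eq_zero.mp h2).resolve_left (pow_ne_zero _ hr.ne')

/-! ### ★★ Translation rigidity of a single-degree field -/

/-- ★★ **TRANSLATION RIGIDITY.**  Let `w : ℝ³ → ℝ³` be differentiable and bounded, `w x = G(‖x − x₀‖) • Λ(x − x₀)` off `x₀` with `Λ`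
differentiable, positively homogeneous of degree `l ≥ 1`, tangent (`⟪y, Λ y⟫ = 0`) and `Λ ξ ≠ 0` for a unit `ξ`, and `G` differentiable on
`(0,∞)`.  If `∂_b w ≡ 0` off `x₀` for some `b ≠ 0`, then `G ≡ 0` on `(0,∞)`.  See the module docstring for the proof. [folklore] -/
theorem vortAmp_eq_zero_of_fderiv_apply_eq_zero {Λ w : EuclideanSpace ℝ (Fin 3) → EuclideanSpace ℝ (Fin 3)}
    (hΛ : Differentiable ℝ Λ) {l : ℕ} (hl : 1 ≤ l)
    (hhom : ∀ r : ℝ, 0 < r → ∀ y : EuclideanSpace ℝ (Fin 3), Λ (r • y) = r ^ l • Λ y)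
    (htan : ∀ y : EuclideanSpace ℝ (Fin 3), ⟪y, Λ y⟫ = 0)
    {ξ : EuclideanSpace ℝ (Fin 3)} (hξ1 : ‖ξ‖ = 1) (hξ : Λ ξ ≠ 0)
    {x₀ : EuclideanSpace ℝ (Fin 3)} (hw : Differentiable ℝ w) {K : ℝ} (hK : ∀ x, ‖w x‖ ≤ K)
    {G : ℝ → ℝ} (hG : ∀ r, 0 < r → DifferentiableAt ℝ G r)
    (hrep : ∀ x, x ≠ x₀ → w x = G ‖x - x₀‖ • Λ (x - x₀))
    {b : EuclideanSpace ℝ (Fin 3)} (hb0 : b ≠ 0) (hb : ∀ x, x ≠ x₀ → fderiv ℝ w x b = 0) :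
    ∀ r, 0 < r → G r = 0 := by
  have hray : ∀ r, 0 < r → ∀ u : EuclideanSpace ℝ (Fin 3), ‖u‖ = 1 →
      (r * deriv G r * ⟪u, b⟫) • Λ u + G r • fderiv ℝ Λ u b = 0 :=
    fun r hr u hu => key_ray hΛ hl hhom hw hG hrep hb hr hu
  have hξ0 : ξ ≠ 0 := by
    intro h; rw [h, norm_zero] at hξ1; exact zero_ne_one hξ1
  have hΛc : Continuous Λ := hΛ.continuous
  by_contra hcon
  push Not at hcon
  obtain ⟨r₁, hr₁, hG₁⟩ := hcon
  by_cases hI : ∃ r₂, 0 < r₂ ∧ G r₁ * (r₂ * deriv G r₂) ≠ G r₂ * (r₁ * deriv G r₁)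
  · /- (I) two independent pairs: `⟪u, b⟫ • Λ u = 0` for every unit `u` -/
    obtain ⟨r₂, hr₂, hD⟩ := hI
    have hperp : ∀ u : EuclideanSpace ℝ (Fin 3), ‖u‖ = 1 → ⟪u, b⟫ ≠ 0 → Λ u = 0 := by
      intro u hu hub
      have h1 := hray r₁ hr₁ u hu
      have h2 := hray r₂ hr₂ u hu
      have h3 : ((G r₂ * (r₁ * deriv G r₁) - G r₁ * (r₂ * deriv G r₂)) * ⟪u, b⟫) • Λ u = 0 := by
        have e1 := congrArg (fun z => G r₂ • z) h1
        have e2 := congrArg (fun z => G r₁ • z) h2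
        simp only [smul_add, smul_smul, smul_zero] at e1 e2
        rw [mul_comm (G r₁) (G r₂)] at e2
        have : (G r₂ * (r₁ * deriv G r₁ * ⟪u, b⟫)) • Λ u - (G r₁ * (r₂ * deriv G r₂ * ⟪u, b⟫)) • Λ u = 0 := by
          have e3 := congrArg₂ (· - ·) e1 e2
          simp only [sub_zero] at e3
          rw [← e3]; abel
        rw [← sub_smul] at this
        convert this using 2
        ring
      rcases smul_eq_zero.mp h3 with h4 | h4
      · exfalso
        rcases mul_eq_zero.mp h4 with h5 | h5
        · exact hD (by linarith)
        · exact hub h5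
      · exact h4
    -- extend to all `y` with `⟪y, b⟫ ≠ 0`
    have hperp' : ∀ y : EuclideanSpace ℝ (Fin 3), ⟪y, b⟫ ≠ 0 → Λ y = 0 := by
      intro y hyb
      have hy0 : y ≠ 0 := by
        intro h; rw [h, inner_zero_left] at hyb; exact hyb rfl
      have hy' : 0 < ‖y‖ := norm_pos_iff.mpr hy0
      set u : EuclideanSpace ℝ (Fin 3) := ‖y‖⁻¹ • y with hu
      have hu1 : ‖u‖ = 1 := by rw [hu, norm_smul, norm_inv, norm_norm, inv_mul_cancel₀ hy'.ne']
      have hyu : y = ‖y‖ • u := by rw [hu, smul_smul, mul_inv_cancel₀ hy'.ne', one_smul]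
      have hub : ⟪u, b⟫ ≠ 0 := by
        rw [hu, real_inner_smul_left]
        exact mul_ne_zero (inv_ne_zero hy'.ne') hyb
      rw [hyu, hhom _ hy' u, hperp u hu1 hub, smul_zero]
    -- `Λ` vanishes at `ξ + ε b` for `ε ≠ 0` small (or at `ξ` itself), hence at `ξ`
    apply hξ
    by_cases hξb : ⟪ξ, b⟫ = 0
    · have hzero : ∀ ε : ℝ, ε ≠ 0 → Λ (ξ + ε • b) = 0 := by
        intro ε hε
        apply hperp'
        rw [inner_add_left, hξb, zero_add, real_inner_smul_left, real_inner_self_eq_norm_sq]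
        exact mul_ne_zero hε (pow_ne_zero 2 (norm_ne_zero_iff.mpr hb0))
      have hc : Tendsto (fun ε : ℝ => Λ (ξ + ε • b)) (𝓝[≠] 0) (𝓝 (Λ ξ)) := by
        have h1 : Continuous fun ε : ℝ => Λ (ξ + ε • b) :=
          hΛc.comp (continuous_const.add (continuous_id.smul continuous_const))
        have h2 := h1.tendsto 0
        simp only [zero_smul, add_zero] at h2
        exact h2.mono_left nhdsWithin_le_nhds
      have hc' : Tendsto (fun ε : ℝ => Λ (ξ + ε • b)) (𝓝[≠] 0) (𝓝 0) := by
        refine tendsto_const_nhds.congr' ?_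
        exact eventually_nhdsWithin_of_forall fun ε hε => (hzero ε hε).symm
      exact tendsto_nhds_unique hc hc'
    · exact hperp' ξ hξb
  · /- (II) all pairs parallel: `r G′ = d G` on `(0,∞)` -/
    push Not at hI
    set d : ℝ := r₁ * deriv G r₁ / G r₁ with hd
    have hode : ∀ r, 0 < r → r * deriv G r = d * G r := by
      intro r hr
      have h1 := hI r hr
      rw [hd]
      field_simp
      linear_combination h1
    -- `M(r) := G r * r ^ l` solves `r M′ = (d + l) M` and is bounded along the ray `x₀ + r ξ`
    set M : ℝ → ℝ := fun r => G r * r ^ l with hM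
    have hMd : ∀ r, 0 < r → HasDerivAt M (deriv G r * r ^ l + G r * ((l : ℝ) * r ^ (l - 1))) r := fun r hr =>
      (hG r hr).hasDerivAt.mul (hasDerivAt_pow l r)
    have hMode : ∀ r, 0 < r → r * deriv M r = (d + l) * M r := by
      intro r hr
      rw [(hMd r hr).deriv, hM]
      have hrl : r * r ^ (l - 1) = r ^ l := by
        rw [← pow_succ']; congr 1; omega
      have := hode r hr
      simp only
      linear_combination r ^ l * this + G r * (l : ℝ) * hrl
    have hΛpos : 0 < ‖Λ ξ‖ := norm_pos_iff.mpr hξ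
    have hMbd : ∀ r, 0 < r → |M r| ≤ K / ‖Λ ξ‖ := by
      intro r hr
      rw [le_div_iff₀ hΛpos, hM]
      have hn : ‖r • ξ‖ = r := by rw [norm_smul, Real.norm_eq_abs, abs_of_pos hr, hξ1, mul_one]
      have hx : x₀ + r • ξ ≠ x₀ := by
        intro h
        have h' : r • ξ = 0 := by simpa using h
        exact smul_ne_zero hr.ne' hξ0 h'
      have h1 := hK (x₀ + r • ξ)
      rw [hrep _ hx, add_sub_cancel_left, hn, hhom r hr ξ, smul_smul, norm_smul, Real.norm_eq_abs] at h1
      simpa using h1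
    have hM₁ : M r₁ ≠ 0 := by
      rw [hM]; exact mul_ne_zero hG₁ (pow_ne_zero l hr₁.ne')
    have hMconst : ∀ r, 0 < r → M r = M r₁ :=
      eq_of_mul_deriv_eq_of_bounded (fun r hr => (hMd r hr).differentiableAt) hMode hr₁ hM₁ hMbd
    -- so `w (x₀ + r u) = M r₁ • Λ u` on every ray
    have hwray : ∀ u : EuclideanSpace ℝ (Fin 3), ‖u‖ = 1 → ∀ r : ℝ, 0 < r → w (x₀ + r • u) = M r₁ • Λ u := by
      intro u hu r hr
      have hu0 : u ≠ 0 := by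
        intro h; rw [h, norm_zero] at hu; exact zero_ne_one hu
      have hn : ‖r • u‖ = r := by rw [norm_smul, Real.norm_eq_abs, abs_of_pos hr, hu, mul_one]
      have hx : x₀ + r • u ≠ x₀ := by
        intro h
        have h' : r • u = 0 := by simpa using h
        exact smul_ne_zero hr.ne' hu0 h'
      rw [hrep _ hx, add_sub_cancel_left, hn, hhom r hr u, smul_smul, ← hMconst r hr]
    -- continuity at the centre: `Λ u = (M r₁)⁻¹ • w x₀` for every unit `u`
    have hwc : Continuous w := hw.continuous
    have hΛu : ∀ u : EuclideanSpace ℝ (Fin 3), ‖u‖ = 1 → Λ u = (M r₁)⁻¹ • w x₀ := by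
      intro u hu
      have h1 : Tendsto (fun r : ℝ => w (x₀ + r • u)) (𝓝[>] 0) (𝓝 (w x₀)) := by
        have hc : Continuous fun r : ℝ => w (x₀ + r • u) :=
          hwc.comp (continuous_const.add (continuous_id.smul continuous_const))
        have h2 := hc.tendsto 0
        simp only [zero_smul, add_zero] at h2
        exact h2.mono_left nhdsWithin_le_nhds
      have h2 : Tendsto (fun r : ℝ => w (x₀ + r • u)) (𝓝[>] 0) (𝓝 (M r₁ • Λ u)) := by
        refine tendsto_const_nhds.congr' ?_
        exact eventually_nhdsWithin_of_forall fun r hr => (hwray u hu r hr).symm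
      have h3 : w x₀ = M r₁ • Λ u := tendsto_nhds_unique h1 h2
      rw [h3, smul_smul, inv_mul_cancel₀ hM₁, one_smul]
    -- tangency forces `w x₀ = 0`, hence `Λ ξ = 0`
    set c : EuclideanSpace ℝ (Fin 3) := (M r₁)⁻¹ • w x₀ with hc
    have hc0 : c = 0 := by
      by_contra hcne
      have hcpos : 0 < ‖c‖ := norm_pos_iff.mpr hcne
      set u : EuclideanSpace ℝ (Fin 3) := ‖c‖⁻¹ • c with hu
      have hu1 : ‖u‖ = 1 := by rw [hu, norm_smul, norm_inv, norm_norm, inv_mul_cancel₀ hcpos.ne']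
      have h1 := htan u
      rw [hΛu u hu1, hu, real_inner_smul_left, real_inner_self_eq_norm_sq] at h1
      have : ‖c‖⁻¹ * ‖c‖ ^ 2 = ‖c‖ := by field_simp
      rw [this] at h1
      exact hcpos.ne' h1
    apply hξ
    rw [hΛu ξ hξ1, hc0]

end Summit.NavierStokesRegularity.NavierStokesRegularity.Theorems.PoloidalLiouville.Antidynamo

end
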